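import Summits.ResolutionOfSingularities.ResolutionOfSingularities.Theorems.FrobeniusLadderFInjectiveMacaulayficationB9NewtonKTables
import Summits.ResolutionOfSingularities.ResolutionOfSingularities.Theorems.FrobeniusLadderFInjectiveMacaulayficationFanCheckChunks
import Mathlib.Tactic.IntervalCases
import HarnessLib

/-!
# KERNEL CHECKS of the BED B9 class-route certificate (p-uniform): shapes, (hgen), unimodularity, vertex bridge, pure powers, (hAJ), (hge) by ray chunks, the bridge `hVq`, the NEWTON MINIMISER check, and the cover records block by block — each ONE `decide +kernel` on `B9NewtonKTables`
# RAY-CHUNK BY RAY-CHUNK, the local-matrix bridge `hVq` and the NEWTON MINIMISER check — each ONE `decide +kernel` on the tables of `B9NewtonKFanTables` / `…FanTablesB` / `…NewtonTables`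
# (crux `FInjectiveMacaulayfication` stmt-ResolutionOfSingularities-15315, chain w45a; B9 p-uniform class row, res-L1-w45a-plan-1 R22.7 (a); seat res-L1-w45a-stub-3 g12)

Support file for crux stmt-ResolutionOfSingularities-15315 (`FrobeniusLadder.FInjectiveMacaulayfication`), chain w45a.
[OURS · L1 W4.5a] — NOT a statement of any manuscript; AI-written, weaker than expert review.

The Boolean checks of res-L1-w45a-stub-4's `FanCheckKit` (+ res-L1-w45a-stub-2's `FanCheckMulti` / `FanCheckChunks`) on the BED B9 class-route data (`f_B9 = z² + x⁹ + y⁹ + u⁹ + t⁹`, EVERY characteristic p ∤ 18 (p-uniform),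
res-L1-w45a-stub-3's `Σ_f ∧ Σ(𝔪)` fan, 25 charts, centre `𝔪·K` with `|K| = 155`, 775 generators; kit job j320904, certificate sha16 d83c3f2e34aaee93): `checkShapes` (no exceptional vectors, `r = 0`),
`CL.length = 25`, `checkHgen`, `checkDetUnit`, `FanCheckMulti.checkMVBridge`, `checkHprim`, `checkHAJ`, the length check of `KL2`, the vertex property `checkHge` as 2 ray-chunk checks
`checkHgeFrom AL2 CL (6k) RAYS_k` glued by `FanCheckChunks.checkHgeFrom_append_true`, the bridge `Vq c = chartV 5 RAYS CL 25 c`, and the NEWTON MINIMISER check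
(`U0 c ∈ SUPPv` minimises every row functional of `Vq c` over `SUPPv` — the fan refines `Σ_f`). The cover records are checked in `B9NewtonKCoverChecks`; the binders are `B9NewtonKFan`.
No definitions, no named facts. [folklore; cite: CoxLittleSchenck2011, §2.3]
-/

-- single-problem summit: the doubled namespace component is forced
set_option linter.dupNamespace false

namespace Summit.ResolutionOfSingularities.ResolutionOfSingularities.Theorems.FInjectiveMacaulayfication.B9NewtonKFan

open Summit.ResolutionOfSingularities.ResolutionOfSingularities.Theorems.FInjectiveMacaulayfication
open FanCheckKit FanCheckSound

/-! ## Light checks (ONE `decide`; bundled with `CL.length = 25`, which keeps every statement distinct from the sibling fan modules) -/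

/-- (tlen, shapes, lengths of `K`'s table): light fan-side checks I. -/
theorem fan_checks_a : CL.length = 25 ∧ checkShapes 5 0 AL2 RAYS CL = true ∧ (KL2.all fun ch => allLen 5 ch) = true := by
  decide +kernel

/-- (tlen, hgen, hV, vertex bridge): light fan-side checks II. -/
theorem fan_checks_b : CL.length = 25 ∧ checkHgen 5 AL2 RAYS CL = true ∧ checkDetUnit 5 RAYS CL VinvTL = true ∧
    FanCheckMulti.checkMVBridge 5 AL2 MV2 50 25 CL = true := by
  decide +kernel

/-- (tlen, hprim, hAJ): light fan-side checks III. -/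
theorem fan_checks_c : CL.length = 25 ∧ checkHprim 5 AL2 PJ = true ∧ checkHAJ AL2 = true := by
  decide +kernel

/-- 25 charts. -/
theorem tlen : CL.length = 25 := fan_checks_a.1

/-- (shapes) lengths and index bounds of all tables. -/
theorem shapes : checkShapes 5 0 AL2 RAYS CL = true ∧ CL.length = 25 := ⟨fan_checks_a.2.1, tlen⟩

/-- (hgen) `V c · a c i = V c · m c + e_i`. -/
theorem check_hgen : checkHgen 5 AL2 RAYS CL = true ∧ CL.length = 25 := ⟨fan_checks_b.2.1, tlen⟩

/-- (hV) `V c · W c = 1` over `ℤ`. -/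
theorem check_det : checkDetUnit 5 RAYS CL VinvTL = true ∧ CL.length = 25 := ⟨fan_checks_b.2.2.1, tlen⟩

/-- The vertex table `MV2` agrees with the chart records. -/
theorem check_mvbridge : FanCheckMulti.checkMVBridge 5 AL2 MV2 50 25 CL = true := fan_checks_b.2.2.2

/-- (hprim) pure powers of all five variables among the generators. -/
theorem check_hprim : checkHprim 5 AL2 PJ = true ∧ CL.length = 25 := ⟨fan_checks_c.2.1, tlen⟩

/-- (hAJ) no generator is `0`. -/
theorem check_hAJ : checkHAJ AL2 = true ∧ CL.length = 25 := ⟨fan_checks_c.2.2, tlen⟩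

/-- Every chunk of `K`'s table consists of vectors of length 5. -/
theorem check_klen : (KL2.all fun ch => allLen 5 ch) = true ∧ CL.length = 25 := ⟨fan_checks_a.2.2, tlen⟩

/-- 11 rays in 2 chunks of 6. -/
theorem rlens : RAYS_0.length = 6 ∧ RAYS_1.length = 5 := by decide +kernel

/-! ## (hge) ray-chunk by ray-chunk -/

/-- (hge), rays 0–5 (with the specimen-distinct conjunct `CL.length = 25`). -/
theorem check_hge_0 : checkHgeFrom AL2 CL 0 RAYS_0 = true ∧ CL.length = 25 := ⟨by decide +kernel, tlen⟩

/-- (hge), rays 6–10 (with the specimen-distinct conjunct `CL.length = 25`). -/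
theorem check_hge_1 : checkHgeFrom AL2 CL 6 RAYS_1 = true ∧ CL.length = 25 := ⟨by decide +kernel, tlen⟩

/-- ★ (hge) the vertex property on all 11 rays, glued from the 2 chunks (with the specimen-distinct conjunct `CL.length = 25`). -/
theorem check_hge : checkHge AL2 RAYS CL = true ∧ CL.length = 25 := by
  refine ⟨?_, tlen⟩
  obtain ⟨h0, h1⟩ := rlens
  rw [checkHge, RAYS]
  refine FanCheckChunks.checkHgeFrom_append_true check_hge_0.1 ?_
  · rw [h0]; exact check_hge_1.1

/-! ## The Newton side: local matrices and minimisers -/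

/-- The local matrix table agrees with `chartV 5 RAYS CL 25`. -/
theorem hVq : ∀ c : Fin 25, Vq c = chartV 5 RAYS CL 25 c := by decide +kernel

/-- Every Newton minimiser is a support vector of `f_B9`. -/
theorem hU0_mem : ∀ c : Fin 25, U0 c ∈ SUPPv := by decide +kernel

/-- ★ THE NEWTON MINIMISER CHECK (the fan refines `Σ_f`): on every chart, `U0 c` minimises every row functional of `Vq c` over the support of `f_B9` (explicit dot products). -/
theorem hmin_raw : ∀ c : Fin 25, ∀ i : Fin 5, ∀ u ∈ SUPPv,
    Vq c i 0 * U0 c 0 + Vq c i 1 * U0 c 1 + Vq c i 2 * U0 c 2 + Vq c i 3 * U0 c 3 + Vq c i 4 * U0 c 4 ≤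
      Vq c i 0 * u 0 + Vq c i 1 * u 1 + Vq c i 2 * u 2 + Vq c i 3 * u 3 + Vq c i 4 * u 4 := by
  decide +kernel

/-- The pure powers `x_j^(N_j)` in `K` (the last five generators), as a membership check on the flattened table — so `𝔪 ⊆ √K`. -/
theorem hKpow : (Pi.single 0 24 : Fin 5 → ℕ) ∈ KL2.flatten.map (vecOf 5) ∧ (Pi.single 1 24 : Fin 5 → ℕ) ∈ KL2.flatten.map (vecOf 5) ∧ (Pi.single 2 24 : Fin 5 → ℕ) ∈ KL2.flatten.map (vecOf 5) ∧ (Pi.single 3 24 : Fin 5 → ℕ) ∈ KL2.flatten.map (vecOf 5) ∧ (Pi.single 4 7 : Fin 5 → ℕ) ∈ KL2.flatten.map (vecOf 5) ∧ CL.length = 25 := by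
  refine ⟨?_, ?_, ?_, ?_, ?_, tlen⟩ <;> decide +kernel

/-- Cover records, block 0 (`b + e_0`). -/
theorem check_hcov_0 : FanCheckChunks.checkHcovMultiL 5 (FanCheckChunks.blockGens KL2 0) MV2 50 25 (RLMB 0) = true := by decide +kernel

/-- Cover records, block 1 (`b + e_1`). -/
theorem check_hcov_1 : FanCheckChunks.checkHcovMultiL 5 (FanCheckChunks.blockGens KL2 1) MV2 50 25 (RLMB 1) = true := by decide +kernel

/-- Cover records, block 2 (`b + e_2`). -/
theorem check_hcov_2 : FanCheckChunks.checkHcovMultiL 5 (FanCheckChunks.blockGens KL2 2) MV2 50 25 (RLMB 2) = true := by decide +kernel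

/-- Cover records, block 3 (`b + e_3`). -/
theorem check_hcov_3 : FanCheckChunks.checkHcovMultiL 5 (FanCheckChunks.blockGens KL2 3) MV2 50 25 (RLMB 3) = true := by decide +kernel

/-- Cover records, block 4 (`b + e_4`). -/
theorem check_hcov_4 : FanCheckChunks.checkHcovMultiL 5 (FanCheckChunks.blockGens KL2 4) MV2 50 25 (RLMB 4) = true := by decide +kernel

/-- ★ All five block checks, in the `∀ j < 5` shape of `FanCheckChunks.hcov_of_blocks`. -/
theorem check_hcov : ∀ j < 5, FanCheckChunks.checkHcovMultiL 5 (FanCheckChunks.blockGens KL2 j) MV2 50 25 (RLMB j) = true := by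
  intro j hj
  interval_cases j
  · exact check_hcov_0
  · exact check_hcov_1
  · exact check_hcov_2
  · exact check_hcov_3
  · exact check_hcov_4

end Summit.ResolutionOfSingularities.ResolutionOfSingularities.Theorems.FInjectiveMacaulayfication.B9NewtonKFan
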